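import Summits.HodgeConjecture.HodgeConjecture.Theorems.EightfoldBlochSeedsBlochSeedsGenericRegularImmersionOfRegularSubscheme
import Literature.AlgebraicGeometry.HodgeTheory.ZeroSchemeRegularImmersion
import HarnessLib

/-!
# Route `EightfoldBlochSeeds`, cruxes `BlochSeedsGeneric` / `BlochSeedDiscThree` (items stmt-HodgeConjecture-18880 / 18882),
# stubs `stub_pad4_carrier` / `stub_rung_pad4_seedAt`: FULTON B.3.4 AS PRINTED — the zero scheme of a section whose frame
# coordinates form a regular sequence IN THE LOCAL RING `𝒪_{X,x}` (not on an affine open) is a regular immersion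

HONEST FRAMING. `--supports` helpers for the zero-locus door of the line (`Theorems/EightfoldBlochSeedsBlochSeedsGenericZeroLocusDoor`,
1-g1: a section `t` of a finite locally free `𝓕` with regular frame coordinates gives the stub bodies); nothing here proves a
stub, (K), the crux, H2, HC_AV or HC. No definition, no named fact (D-0026).

WHAT. The tree's `HodgeTheory.isRegularImmersionOfCodim_zeroSchemeι(_of_isFiniteLocallyFree)` (Fulton B.3.4) asks for the
frame coordinates `λ_{σ 0}(t|_V), …, λ_{σ (r-1)}(t|_V)` to be a weakly regular sequence of the RING OF SECTIONS `Γ(X, V)` on an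
affine open `V`; Fulton's printed criterion is at the LOCAL RING («`(*)` is exact at `x` iff `s_1, …, s_r` is a regular
sequence of elements in `𝒪_{x,X}`»). With `isRegularImmersionOfCodim_of_stalks` (this hand, EGA IV 17.12.1 spreading) the
stalk form follows:

* `isRegularImmersionOfCodim_zeroSchemeι_of_germs` (+ `_of_isFiniteLocallyFree`) — germs of the coordinates weakly regular in
  `𝒪_{X,x}` at every point of `Z(t)` ⟹ `IsRegularImmersionOfCodim (zeroSchemeι E t) r`;
* `isRegularImmersionOfCodim_zeroSchemeι_of_isRsopPart` — the SMOOTH-POINT form: if at every point of `Z(t)` the germs of the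
  coordinates are part of a regular system of parameters of (the regular local ring) `𝒪_{X,x}` — i.e. `dλ_1, …, dλ_r` linearly
  independent in `𝔪_x/𝔪_x²` — then `Z(t) ⟶ X` is a regular immersion of codimension `r` (`IsRsopPart.isWeaklyRegular_ofFn`).

[cite: Fulton1998, App. B.3.4 (PDF p. 411)] [cite: EGAIV4, Prop. 17.12.1] [cite: GortzWedhorn2023, Def. 19.19 and Def. 19.23]
[cite: Matsumura1987, Thm. 14.2]
-/

noncomputable section

-- single-problem summit (Problem = Summit): the mandated namespace repeats `HodgeConjecture`.
set_option linter.dupNamespace false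

open CategoryTheory AlgebraicGeometry Opposite TopologicalSpace
open Literature.AlgebraicGeometry.HodgeTheory Literature.AlgebraicGeometry.Resolution
open Literature.AlgebraicGeometry.Modules Literature.AlgebraicGeometry.Motives Literature.AlgebraicGeometry.Morphisms

namespace Summit.HodgeConjecture.HodgeConjecture.Theorems

universe u

variable {X : Scheme.{u}} [IsLocallyNoetherian X] {E : X.Modules} {I : Type u} [Fintype I] {r : ℕ}

/-- **Fulton B.3.4 at the local rings**: for `E^∨` affine-localizing and a section `t` of `E`, if every point `x` of `Z(t)`
has an affine open `V ∋ x` inside a frame open `W` (`e : 𝒪^I ≅ E|_W`, `σ : Fin r ≃ I`) such that the GERMS at `x` of the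
coordinates `λ_{σ 0}(t|_V), …, λ_{σ (r-1)}(t|_V)` form a weakly regular sequence of `𝒪_{X,x}`, then `Z(t) ⟶ X` is a regular
immersion of codimension `r` (on a locally Noetherian `X`). [cite: Fulton1998, App. B.3.4] [cite: EGAIV4, Prop. 17.12.1] -/
theorem isRegularImmersionOfCodim_zeroSchemeι_of_germs (hE : IsAffineLocalizing (dual E)) (t : Γ(E, ⊤))
    (h : ∀ z : zeroScheme E t, ∃ (V : X.affineOpens) (W : X.Opens) (k : (V : X.Opens) ⟶ W)
      (e : SheafOfModules.free I ≅ E.over W) (σ : Fin r ≃ I) (hzV : (zeroSchemeι E t).base z ∈ (V : X.Opens)),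
        RingTheory.Sequence.IsWeaklyRegular (X.presheaf.stalk ((zeroSchemeι E t).base z))
          ((List.ofFn fun j => coord e k (resTop E t V) (σ j)).map
            (X.presheaf.germ V ((zeroSchemeι E t).base z) hzV).hom)) :
    IsRegularImmersionOfCodim (zeroSchemeι E t) r := by
  haveI := isClosedImmersion_zeroSchemeι E t
  refine isRegularImmersionOfCodim_of_stalks (zeroSchemeι E t) fun z => ?_
  obtain ⟨V, W, k, e, σ, hzV, hreg⟩ := h z
  have hI := ker_zeroSchemeι_ideal_eq_ofList hE t e σ V k
  refine ⟨V, hzV, List.ofFn fun j => coord e k (resTop E t V) (σ j), List.length_ofFn, ?_, hreg, ?_⟩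
  · intro s hs
    rw [hI]
    exact Ideal.subset_span hs
  · rw [stalkIdeal_eq_map_germ _ V hzV, hI]

/-- **Fulton B.3.4 at the local rings, for vector bundles** (`E` finite locally free).
[cite: Fulton1998, App. B.3.4] [cite: EGAIV4, Prop. 17.12.1] -/
theorem isRegularImmersionOfCodim_zeroSchemeι_of_germs_of_isFiniteLocallyFree (hE : IsFiniteLocallyFree E) (t : Γ(E, ⊤))
    (h : ∀ z : zeroScheme E t, ∃ (V : X.affineOpens) (W : X.Opens) (k : (V : X.Opens) ⟶ W)
      (e : SheafOfModules.free I ≅ E.over W) (σ : Fin r ≃ I) (hzV : (zeroSchemeι E t).base z ∈ (V : X.Opens)),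
        RingTheory.Sequence.IsWeaklyRegular (X.presheaf.stalk ((zeroSchemeι E t).base z))
          ((List.ofFn fun j => coord e k (resTop E t V) (σ j)).map
            (X.presheaf.germ V ((zeroSchemeι E t).base z) hzV).hom)) :
    IsRegularImmersionOfCodim (zeroSchemeι E t) r :=
  isRegularImmersionOfCodim_zeroSchemeι_of_germs (isAffineLocalizing_dual_of_isFiniteLocallyFree hE) t h

/-- **The smooth-point form**: if at every point `x` of `Z(t)` the germs of the `r` frame coordinates of `t` are PART OF A
REGULAR SYSTEM OF PARAMETERS of `𝒪_{X,x}` (`Resolution.IsRsopPart`; equivalently `𝒪_{X,x}` is regular and the coordinates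
are linearly independent in `𝔪_x/𝔪_x²` — the Jacobian criterion for `Z(t)` to be smooth of codimension `r` at `x`), then
`Z(t) ⟶ X` is a regular immersion of codimension `r` (`IsRsopPart.isWeaklyRegular_ofFn`, Matsumura 14.2–14.3).
[cite: Fulton1998, App. B.3.4] [cite: Matsumura1987, Thm. 14.2] [cite: EGAIV4, Prop. 17.12.1] -/
theorem isRegularImmersionOfCodim_zeroSchemeι_of_isRsopPart (hE : IsAffineLocalizing (dual E)) (t : Γ(E, ⊤))
    (h : ∀ z : zeroScheme E t, ∃ (V : X.affineOpens) (W : X.Opens) (k : (V : X.Opens) ⟶ W)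
      (e : SheafOfModules.free I ≅ E.over W) (σ : Fin r ≃ I) (hzV : (zeroSchemeι E t).base z ∈ (V : X.Opens)),
        IsRsopPart fun j => (X.presheaf.germ V ((zeroSchemeι E t).base z) hzV).hom (coord e k (resTop E t V) (σ j))) :
    IsRegularImmersionOfCodim (zeroSchemeι E t) r := by
  refine isRegularImmersionOfCodim_zeroSchemeι_of_germs (I := I) (r := r) hE t fun z => ?_
  obtain ⟨V, W, k, e, σ, hzV, hrsop⟩ := h z
  refine ⟨V, W, k, e, σ, hzV, ?_⟩
  rw [List.map_ofFn]
  exact IsRsopPart.isWeaklyRegular_ofFn hrsop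

end Summit.HodgeConjecture.HodgeConjecture.Theorems

end
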